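/-
Origin: expansion seat `planner-pub-hodgecm-pv14-g6-0`, handover import Pv14g6.SchwartzOfRealSlope -> import HodgeCM.Automorphic.SchwartzOfRealSlope ; after t31 row 9 (SchwartzOfRealSlope) (`HOME/pub-hodgecm-pv14-g6/lean/Pv14g6/SchwartzHyperbolicFlow.lean`, md5 c90b6baa, 232 lines);
landed by the gen-8 packager in gate run 31 as `HodgeCM/Automorphic/SchwartzHyperbolicFlow.lean` (import ^import Pv14g6\.SchwartzOfRealSlope[ \t]*$→import HodgeCM.Automorphic.SchwartzOfRealSlope ×1).
-/
/-
Copyright: HodgeCM public adjudication package, seat pub-hodgecm-pv14-g6 (DAG-NODE PROVER #14, gen 6).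
File #25 of this seat.  Kernel-checked, no new axioms.  Imports file #24 (hence #15, #16, #19–#22)
of this seat and Mathlib only.
-/
import Summits.HodgeConjecture.HodgeCM.Automorphic.SchwartzOfRealSlope
import Mathlib.Analysis.SpecialFunctions.Trigonometric.DerivHyp

/-!
# Hyperbolic one-parameter groups `exp(sJ) = cosh s · 1 + sinh s · J` (`J² = 1`) on Schwartz space

The one real direction left per place of type `Σ₁₂` in the end-state records of this package is, on
the Schrödinger side, the linear flow of a hyperbolic element `J` with `J² = 1` — e.g.
`X₁ = [[0,-1],[-1,0]] ⊗ 1 : (x, y) ↦ (-y, -x)` on a doubled space, whose flow is the hyperbolic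
rotation `(x, y) ↦ (cosh s · x - sinh s · y, cosh s · y - sinh s · x)` (the creation/annihilation
substitution turns `P·_ - Δ` into the first-order operator `-Σ_a (x_a ∂_{y_a} + y_a ∂_{x_a})`).
For ANY continuous linear `J : E → E` with `J * J = 1` on a real normed space `E` this file makes
`exp(sJ) = cosh s · 1 + sinh s · J` a named one-parameter group of continuous linear automorphisms
(`involFlow J hJ s`; group law `involFlow_add_apply`; operator-norm derivative `J` at `0`,
`hasDerivAt_coe_involFlow`) and instantiates the general theorems of files #16, #21, #24:

* `tendsto_compCLM_involFlow_sub_div_at` — in the topology of `𝓢(E, F)`, at every base point,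
  `s⁻¹ • (Φ ∘ exp((s₀+s)J) - Φ ∘ exp(s₀J)) → flowGen J (Φ ∘ exp(s₀J))`
  (`flowGen J Φ x = DΦ(x)[J x]`);
* `hasDerivAt_apply_compCLM_involFlow`, `contDiff_apply_compCLM_involFlow`,
  `iteratedDeriv_apply_compCLM_involFlow` — scalar coefficients are `C^∞`;
* `tendsto_compCLM_sub_div_at_ofReal` (any linear group) and
  `tendsto_compCLM_involFlow_sub_div_ofReal(_at)` — the complex-scalar forms `((s : ℂ))⁻¹ • (…)`;
* the doubled-space example: `hypGen V : (x, y) ↦ (-y, -x)` on `V × V`, `hypGen_mul_hypGen`,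
  `hypFlow V s = involFlow (hypGen V) _ s`, `hypFlow_apply`, `flowGen_hypGen_apply`
  (`= -DΦ(x, y)[(y, x)]`), `tendsto_compCLM_hypFlow_sub_div_ofReal`.

The same construction with `J` a coordinate "swap-and-negate" map on a function space `ι ⊕ ι → ℝ`
gives the flow in coordinates.  Only published mathematics is used (Mathlib); nothing here refers to
the objects under adjudication — in particular no identification of a constructed model operator
with this flow is asserted.
-/

noncomputable section

open Filter Topology
open scoped SchwartzMap ContDiff

namespace HodgeCM
namespace SchwartzWeil

/-! ## `exp(sJ)` for an involutive generator -/

section Involutive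

variable {E : Type*} [NormedAddCommGroup E] [NormedSpace ℝ E] (J : E →L[ℝ] E)

/-- `exp(sJ) = cosh s · 1 + sinh s · J` as a continuous linear map (valid when `J² = 1`). -/
def coshSinhCLM (s : ℝ) : E →L[ℝ] E := Real.cosh s • 1 + Real.sinh s • J

/-- (Ported verbatim from the HodgeCMPerL package; no docstring in the source.) -/
theorem coshSinhCLM_apply (s : ℝ) (x : E) : coshSinhCLM J s x = Real.cosh s • x + Real.sinh s • J x := by
  simp [coshSinhCLM]

/-- (Ported verbatim from the HodgeCMPerL package; no docstring in the source.) -/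
theorem coshSinhCLM_zero : coshSinhCLM J 0 = 1 := by
  simp [coshSinhCLM]

/-- The group law `exp((s+t)J) = exp(sJ) exp(tJ)` from the addition formulas and `J² = 1`. -/
theorem coshSinhCLM_add (hJ : J * J = 1) (s t : ℝ) :
    coshSinhCLM J (s + t) = coshSinhCLM J s * coshSinhCLM J t := by
  simp only [coshSinhCLM, Real.cosh_add, Real.sinh_add, mul_add, add_mul, smul_mul_smul_comm, mul_one,
    one_mul, hJ, add_smul]
  abel

/-- The one-parameter group `s ↦ exp(sJ)` of continuous linear automorphisms (inverse `exp(-sJ)`). -/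
def involFlow (hJ : J * J = 1) (s : ℝ) : E ≃L[ℝ] E :=
  ContinuousLinearEquiv.unitsEquiv ℝ E
    ⟨coshSinhCLM J s, coshSinhCLM J (-s),
      by rw [← coshSinhCLM_add J hJ, add_neg_cancel, coshSinhCLM_zero],
      by rw [← coshSinhCLM_add J hJ, neg_add_cancel, coshSinhCLM_zero]⟩

variable (hJ : J * J = 1)

/-- (Ported verbatim from the HodgeCMPerL package; no docstring in the source.) -/
theorem coe_involFlow (s : ℝ) : ((involFlow J hJ s : E ≃L[ℝ] E) : E →L[ℝ] E) = coshSinhCLM J s := by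
  ext x
  rfl

/-- (Ported verbatim from the HodgeCMPerL package; no docstring in the source.) -/
@[simp] theorem involFlow_apply (s : ℝ) (x : E) :
    involFlow J hJ s x = Real.cosh s • x + Real.sinh s • J x := by
  rw [show involFlow J hJ s x = coshSinhCLM J s x from rfl, coshSinhCLM_apply]

/-- (Ported verbatim from the HodgeCMPerL package; no docstring in the source.) -/
theorem coe_involFlow_zero : ((involFlow J hJ 0 : E ≃L[ℝ] E) : E →L[ℝ] E) = 1 := by
  rw [coe_involFlow, coshSinhCLM_zero]

/-- (Ported verbatim from the HodgeCMPerL package; no docstring in the source.) -/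
theorem involFlow_add_apply (s t : ℝ) (x : E) :
    involFlow J hJ (s + t) x = involFlow J hJ s (involFlow J hJ t x) := by
  show coshSinhCLM J (s + t) x = coshSinhCLM J s (coshSinhCLM J t x)
  rw [coshSinhCLM_add J hJ]
  rfl

/-- The operator-norm derivative of `s ↦ exp(sJ)` at `0` is `J`. -/
theorem hasDerivAt_coe_involFlow :
    HasDerivAt (fun s => ((involFlow J hJ s : E ≃L[ℝ] E) : E →L[ℝ] E)) J 0 := by
  have h := ((Real.hasDerivAt_cosh 0).smul_const (1 : E →L[ℝ] E)).add
    ((Real.hasDerivAt_sinh 0).smul_const J)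
  rw [Real.sinh_zero, Real.cosh_zero, zero_smul, one_smul, zero_add] at h
  refine h.congr_of_eventuallyEq (Eventually.of_forall fun s => ?_)
  exact coe_involFlow J hJ s

end Involutive

/-! ## The flow on Schwartz space -/

section Schwartz

variable {E F G : Type*} [NormedAddCommGroup E] [NormedSpace ℝ E] [NormedAddCommGroup F]
  [NormedSpace ℝ F] [NormedAddCommGroup G] [NormedSpace ℝ G]
variable (𝕜 : Type*) [RCLike 𝕜] [NormedSpace 𝕜 F] [SMulCommClass ℝ 𝕜 F]
variable (J : E →L[ℝ] E) (hJ : J * J = 1)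

/-- **`exp(sJ)` is differentiable in the Schwartz topology, at every base point**:
`s⁻¹ • (Φ ∘ exp((s₀+s)J) - Φ ∘ exp(s₀J)) → flowGen J (Φ ∘ exp(s₀J))` in `𝓢(E, F)`. -/
theorem tendsto_compCLM_involFlow_sub_div_at (Φ : 𝓢(E, F)) (s₀ : ℝ) :
    Tendsto (fun s : ℝ => s⁻¹ • (SchwartzMap.compCLMOfContinuousLinearEquiv 𝕜 (involFlow J hJ (s₀ + s)) Φ
        - SchwartzMap.compCLMOfContinuousLinearEquiv 𝕜 (involFlow J hJ s₀) Φ)) (𝓝[≠] 0)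
      (𝓝 (flowGen J (SchwartzMap.compCLMOfContinuousLinearEquiv 𝕜 (involFlow J hJ s₀) Φ))) :=
  tendsto_compCLM_sub_div_at 𝕜 (coe_involFlow_zero J hJ) (hasDerivAt_coe_involFlow J hJ)
    (involFlow_add_apply J hJ) Φ s₀

/-- Every scalar coefficient `s ↦ T (Φ ∘ exp(sJ))` is differentiable, with derivative
`T (flowGen J (Φ ∘ exp(s₀J)))`. -/
theorem hasDerivAt_apply_compCLM_involFlow (T : 𝓢(E, F) →L[ℝ] G) (Φ : 𝓢(E, F)) (s₀ : ℝ) :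
    HasDerivAt (fun s => T (SchwartzMap.compCLMOfContinuousLinearEquiv 𝕜 (involFlow J hJ s) Φ))
      (T (flowGen J (SchwartzMap.compCLMOfContinuousLinearEquiv 𝕜 (involFlow J hJ s₀) Φ))) s₀ :=
  hasDerivAt_apply_compCLM 𝕜 T (coe_involFlow_zero J hJ) (hasDerivAt_coe_involFlow J hJ)
    (involFlow_add_apply J hJ) Φ s₀

/-- Every scalar coefficient `s ↦ T (Φ ∘ exp(sJ))` is `C^∞` on `ℝ`. -/
theorem contDiff_apply_compCLM_involFlow (T : 𝓢(E, F) →L[ℝ] G) (Φ : 𝓢(E, F)) :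
    ContDiff ℝ ∞ (fun s : ℝ => T (SchwartzMap.compCLMOfContinuousLinearEquiv 𝕜 (involFlow J hJ s) Φ)) :=
  contDiff_apply_compCLM 𝕜 T (coe_involFlow_zero J hJ) (hasDerivAt_coe_involFlow J hJ)
    (involFlow_add_apply J hJ) Φ

/-- Its iterated derivatives: `(d/ds)^k T (Φ ∘ exp(sJ)) = T ((flowGen J)^k (Φ ∘ exp(sJ)))`. -/
theorem iteratedDeriv_apply_compCLM_involFlow (T : 𝓢(E, F) →L[ℝ] G) (Φ : 𝓢(E, F)) (k : ℕ) :
    iteratedDeriv k (fun s : ℝ => T (SchwartzMap.compCLMOfContinuousLinearEquiv 𝕜 (involFlow J hJ s) Φ))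
      = fun s => T ((flowGen J)^[k]
          (SchwartzMap.compCLMOfContinuousLinearEquiv 𝕜 (involFlow J hJ s) Φ)) :=
  iteratedDeriv_apply_compCLM 𝕜 T (coe_involFlow_zero J hJ) (hasDerivAt_coe_involFlow J hJ)
    (involFlow_add_apply J hJ) Φ k

end Schwartz

/-! ## Complex-scalar forms -/

section Complex

variable {E F : Type*} [NormedAddCommGroup E] [NormedSpace ℝ E] [NormedAddCommGroup F]
  [NormedSpace ℝ F] [NormedSpace ℂ F] [IsScalarTower ℝ ℂ F] [SMulCommClass ℝ ℂ F]
variable {L : ℝ → E ≃L[ℝ] E} {A : E →L[ℝ] E}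

/-- **Linear one-parameter groups at every base point, complex scalars**:
`((s : ℂ))⁻¹ • (Φ ∘ L (s₀+s) - Φ ∘ L s₀) → flowGen A (Φ ∘ L s₀)` in `𝓢(E, F)`. -/
theorem tendsto_compCLM_sub_div_at_ofReal (hL0 : ((L 0 : E ≃L[ℝ] E) : E →L[ℝ] E) = 1)
    (hL : HasDerivAt (fun s => ((L s : E ≃L[ℝ] E) : E →L[ℝ] E)) A 0)
    (hmul : ∀ s t x, L (s + t) x = L s (L t x)) (Φ : 𝓢(E, F)) (s₀ : ℝ) :
    Tendsto (fun s : ℝ => ((s : ℂ))⁻¹ • (SchwartzMap.compCLMOfContinuousLinearEquiv ℂ (L (s₀ + s)) Φ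
        - SchwartzMap.compCLMOfContinuousLinearEquiv ℂ (L s₀) Φ)) (𝓝[≠] 0)
      (𝓝 (flowGen A (SchwartzMap.compCLMOfContinuousLinearEquiv ℂ (L s₀) Φ))) :=
  tendsto_ofReal_inv_smul_iff.2 (tendsto_compCLM_sub_div_at ℂ hL0 hL hmul Φ s₀)

variable (J : E →L[ℝ] E) (hJ : J * J = 1)

/-- **`exp(sJ)` with complex scalars, at every base point.** -/
theorem tendsto_compCLM_involFlow_sub_div_ofReal_at (Φ : 𝓢(E, F)) (s₀ : ℝ) :
    Tendsto (fun s : ℝ => ((s : ℂ))⁻¹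
        • (SchwartzMap.compCLMOfContinuousLinearEquiv ℂ (involFlow J hJ (s₀ + s)) Φ
          - SchwartzMap.compCLMOfContinuousLinearEquiv ℂ (involFlow J hJ s₀) Φ)) (𝓝[≠] 0)
      (𝓝 (flowGen J (SchwartzMap.compCLMOfContinuousLinearEquiv ℂ (involFlow J hJ s₀) Φ))) :=
  tendsto_compCLM_sub_div_at_ofReal (coe_involFlow_zero J hJ) (hasDerivAt_coe_involFlow J hJ)
    (involFlow_add_apply J hJ) Φ s₀

/-- **`exp(sJ)` with complex scalars at `0`** — the literal shape of the smooth-vector clauses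
`((s : ℂ))⁻¹ • (ω(e s)v - ω(e 0)v) → X v`: `((s : ℂ))⁻¹ • (Φ ∘ exp(sJ) - Φ) → flowGen J Φ`. -/
theorem tendsto_compCLM_involFlow_sub_div_ofReal (Φ : 𝓢(E, F)) :
    Tendsto (fun s : ℝ => ((s : ℂ))⁻¹
        • (SchwartzMap.compCLMOfContinuousLinearEquiv ℂ (involFlow J hJ s) Φ - Φ)) (𝓝[≠] 0)
      (𝓝 (flowGen J Φ)) :=
  tendsto_compCLM_sub_div_ofReal (coe_involFlow_zero J hJ) (hasDerivAt_coe_involFlow J hJ) Φ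

end Complex

/-! ## The doubled-space example `X₁ : (x, y) ↦ (-y, -x)` on `V × V` -/

section Doubled

variable (V : Type*) [NormedAddCommGroup V] [NormedSpace ℝ V]

/-- The hyperbolic generator `X₁ = [[0,-1],[-1,0]] ⊗ 1 : (x, y) ↦ (-y, -x)` on `V × V`. -/
def hypGen : (V × V) →L[ℝ] (V × V) :=
  -((ContinuousLinearMap.snd ℝ V V).prod (ContinuousLinearMap.fst ℝ V V))

/-- (Ported verbatim from the HodgeCMPerL package; no docstring in the source.) -/
@[simp] theorem hypGen_apply (p : V × V) : hypGen V p = (-p.2, -p.1) := by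
  simp [hypGen]

/-- `X₁² = 1`. -/
theorem hypGen_mul_hypGen : hypGen V * hypGen V = 1 := by
  ext p <;> simp

/-- The hyperbolic rotation `exp(s X₁)` of `V × V`. -/
def hypFlow (s : ℝ) : (V × V) ≃L[ℝ] (V × V) := involFlow (hypGen V) (hypGen_mul_hypGen V) s

/-- (Ported verbatim from the HodgeCMPerL package; no docstring in the source.) -/
@[simp] theorem hypFlow_apply (s : ℝ) (p : V × V) :
    hypFlow V s p = (Real.cosh s • p.1 - Real.sinh s • p.2, Real.cosh s • p.2 - Real.sinh s • p.1) := by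
  refine Prod.ext ?_ ?_ <;> simp [hypFlow, sub_eq_add_neg]

variable {V}
variable {F : Type*} [NormedAddCommGroup F] [NormedSpace ℝ F]

/-- The generator on Schwartz space: `flowGen X₁ Φ (x, y) = -DΦ(x, y)[(y, x)]`. -/
theorem flowGen_hypGen_apply (Φ : 𝓢(V × V, F)) (p : V × V) :
    flowGen (hypGen V) Φ p = -(fderiv ℝ (Φ : V × V → F) p (p.2, p.1)) := by
  rw [flowGen_apply, hypGen_apply, show ((-p.2, -p.1) : V × V) = -(p.2, p.1) from rfl, map_neg]

variable [NormedSpace ℂ F] [IsScalarTower ℝ ℂ F] [SMulCommClass ℝ ℂ F]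

/-- **The hyperbolic rotation flow on `𝓢(V × V, F)` with complex scalars at `0`**:
`((s : ℂ))⁻¹ • (Φ ∘ hypFlow s - Φ) → flowGen X₁ Φ`. -/
theorem tendsto_compCLM_hypFlow_sub_div_ofReal (Φ : 𝓢(V × V, F)) :
    Tendsto (fun s : ℝ => ((s : ℂ))⁻¹
        • (SchwartzMap.compCLMOfContinuousLinearEquiv ℂ (hypFlow V s) Φ - Φ)) (𝓝[≠] 0)
      (𝓝 (flowGen (hypGen V) Φ)) :=
  tendsto_compCLM_involFlow_sub_div_ofReal (hypGen V) (hypGen_mul_hypGen V) Φ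

end Doubled

end SchwartzWeil
end HodgeCM
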